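import Mathlib
import HarnessLib
import Summits.ValiantsHypothesis.ValiantsHypothesis.Theses.MonotoneRestoration
import Summits.ValiantsHypothesis.ValiantsHypothesis.Theorems.MonotoneRestorationSensitiveBridge
import Summits.ValiantsHypothesis.ValiantsHypothesis.Theorems.MonotoneRestorationTargetImpliesCrux
import Summits.ValiantsHypothesis.ValiantsHypothesis.Theorems.MonotoneRestorationMonotoneRestorationQPSymmetricLB
import Summits.ValiantsHypothesis.ValiantsHypothesis.Theorems.MonotoneRestorationMonotoneRestorationQPNonInjective
import Literature.ModelTheory.FiniteModelTheory.DawarWilsenach2025Thm72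
import Literature.ModelTheory.FiniteModelTheory.CountingWidth
import Literature.Computability.AlgebraicComplexity.DawarWilsenach2025Proofs
import Summits.ValiantsHypothesis.ValiantsHypothesis.Theorems.MonotoneRestorationQP.Negative.LoadBearing

/-!
# Route MonotoneRestoration — status of the kill witness `PolylogWidthMonotoneEasy`

Support file for item `stmt-ValiantsHypothesis-17619`
(`Summit.ValiantsHypothesis.ValiantsHypothesis.Theses.MonotoneRestoration.PolylogWidthMonotoneEasy`,
the route's KILL WITNESS: a matrix-symmetric family over `ℝ≥0` of polynomial degree and polynomial
MONOTONE complexity whose complexification separates, for every `c` beyond every `N`, two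
`C^{(log₂ m + c)^c}`-equivalent graphs on `m` vertices).

Two structural facts about the item, both sorry-free:

* `polylogWidthMonotoneEasy_iff_nonnegVP` — the MONOTONE hypothesis is removable: the witness exists
  iff some matrix-symmetric family over `ℝ≥0` whose complexification is a `VP` family (tree
  `IsVPFamily`) separates polylog-equivalent graphs in the same sense. (`→`: a monotone circuit is a
  circuit, `ArithCircuit.complexity_map_le`; `←`: Hrubeš's bridge `SensitiveBridge`, PROVED in the
  tree as `sensitiveBridge_proof`, replaces `h_n` by the monotone-easy `g_n` with
  `map g_n = (1 + Σ x)^d + ε · map h_n`, `ε > 0`, and `(1 + Σ x)^d` takes equal values on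
  `C^2`-equivalent graphs — equal numbers of edges along Duplicator's two bijections.) So the item
  is the nonnegative-coefficient, matrix-symmetric, graph-evaluated form of Dwivedi–Pago–Seppelt
  2026, Outlook Q3 ("is there a symmetric VP family outside symVP / of unbounded counting width?").
* `valiantsHypothesis_of_not_polylogWidthMonotoneEasy` — REFUTING the item proves the summit:
  if `VP_ℂ = VNP_ℂ` then the permanent over `ℝ≥0` is such a nonnegative matrix-symmetric `VP` family,
  and it separates the `C^k`-equivalent CFI matching graphs of Dawar–Wilsenach 2025, Thm 7.2
  (`DawarWilsenach2025_thm72_family`, PROVED: `m ≤ c₀ k + c₀` vertices, different numbers of perfect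
  matchings, hence different permanents `eval_perPoly_adj_ne_of_card_perfectMatchings_ne`) at the
  polylog level `(log₂ m + c)^c ≤ k` (`symmetricLB_logPow_lt`). Hence `¬ PolylogWidthMonotoneEasy →
  VP_ℂ ≠ VNP_ℂ`: the negative side of this item is at least as hard as Valiant's hypothesis, and the
  only way to SETTLE the item short of the summit is to PROVE it (an explicit witness).

No new definitions.
-/

set_option linter.dupNamespace false

namespace Summit.ValiantsHypothesis.ValiantsHypothesis.Theorems

open Summit.ValiantsHypothesis.ValiantsHypothesis.Theses.MonotoneRestoration
open Literature.Computability.AlgebraicComplexity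
open Literature.ModelTheory.FiniteModelTheory

/-! ### `C^2`-equivalent graphs have the same number of edges -/

open Classical in
/-- `C^2`-equivalent finite graphs have the same number of (ordered) edges, written as the sum of
all entries of the `0/1` adjacency matrix: Duplicator's first bijection `f` and second bijections
`g_a` match the rows (`ckEquiv_exists_local_bijection`). [folklore] -/
theorem ckEquiv_sum_adj_eq {α β : Type*} [Fintype α] [Fintype β] {X : SimpleGraph α}
    {Y : SimpleGraph β} {k : ℕ} (h : CkEquiv k X Y) (hk : 2 ≤ k) (R : Type*) [CommSemiring R] :
    ∑ a : α, ∑ b : α, (if X.Adj a b then (1 : R) else 0) =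
      ∑ v : β, ∑ w : β, (if Y.Adj v w then (1 : R) else 0) := by
  obtain ⟨f, hf⟩ := ckEquiv_exists_local_bijection h hk
  rw [← f.sum_comp (fun v : β => ∑ w : β, (if Y.Adj v w then (1 : R) else 0))]
  refine Fintype.sum_congr _ _ fun a => ?_
  obtain ⟨g, hg⟩ := hf a
  rw [← g.sum_comp (fun w : β => if Y.Adj (f a) w then (1 : R) else 0)]
  refine Fintype.sum_congr _ _ fun b => ?_
  rw [hg b]

open Classical in
/-- The `0/1` adjacency matrix written with `Set.indicator` is the `if … then 1 else 0` matrix.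
[folklore] -/
theorem indicator_adj_eq_ite {m : ℕ} (Γ : SimpleGraph (Fin m)) :
    Set.indicator {ij : Fin m × Fin m | Γ.Adj ij.1 ij.2} (1 : Fin m × Fin m → ℂ) =
      fun ij : Fin m × Fin m => if Γ.Adj ij.1 ij.2 then (1 : ℂ) else 0 := by
  funext ij
  by_cases h : Γ.Adj ij.1 ij.2 <;> simp [h]

open Classical in
/-- The dense easy polynomial `(1 + Σ_ij x_ij)^d` takes the same value at the adjacency matrices of
two `C^2`-equivalent graphs on `Fin m` (same number of edges), over any commutative semiring.
[folklore] -/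
theorem eval_densePart_eq_of_ckEquiv {m k : ℕ} {X Y : SimpleGraph (Fin m)} (h : CkEquiv k X Y)
    (hk : 2 ≤ k) (R : Type*) [CommSemiring R] (d : ℕ) :
    MvPolynomial.eval (fun ij : Fin m × Fin m => if X.Adj ij.1 ij.2 then (1 : R) else 0)
        ((1 + ∑ p : Fin m × Fin m, MvPolynomial.X p) ^ d) =
      MvPolynomial.eval (fun ij : Fin m × Fin m => if Y.Adj ij.1 ij.2 then (1 : R) else 0)
        ((1 + ∑ p : Fin m × Fin m, MvPolynomial.X p) ^ d) := by
  simp only [map_pow, map_add, map_one, map_sum, MvPolynomial.eval_X]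
  rw [Fintype.sum_prod_type, Fintype.sum_prod_type, ckEquiv_sum_adj_eq h hk R]

/-! ### From linearly many vertices to the polylog level -/

/-- **Linear order of the test graphs reaches every polylog level.** If `m k ≤ c₀ k + c₀` and
`k < m k` for all `k`, then for all `c, N` some index `k` has `N ≤ m k` and
`(log₂ (m k) + c)^c ≤ k` (quasi-polynomial against linear, `symmetricLB_logPow_lt`). [folklore] -/
theorem exists_index_polylog_le (c₀ : ℕ) {m : ℕ → ℕ} (hm : ∀ k, m k ≤ c₀ * k + c₀)
    (hkm : ∀ k, k < m k) (c N : ℕ) : ∃ k : ℕ, N ≤ m k ∧ (Nat.log 2 (m k) + c) ^ c ≤ k := by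
  have hδ : (0 : ℝ) < 1 / (2 * (c₀ : ℝ) + 2) := by positivity
  obtain ⟨k₀, hk₀⟩ := symmetricLB_logPow_lt c hδ
  refine ⟨max (2 ^ k₀) (max N 1), ?_, ?_⟩
  · have h1 := hkm (max (2 ^ k₀) (max N 1))
    have h2 : N ≤ max (2 ^ k₀) (max N 1) := le_trans (le_max_left _ _) (le_max_right _ _)
    omega
  · set k : ℕ := max (2 ^ k₀) (max N 1) with hkdef
    have hk1 : 1 ≤ k := le_trans (le_max_right _ _) (le_max_right _ _)
    have hk2 : 2 ^ k₀ ≤ k := le_max_left _ _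
    have hmk : 2 ^ k₀ ≤ m k := le_of_lt (lt_of_le_of_lt hk2 (hkm k))
    have h1 := hk₀ (m k) hmk
    have h2 : (1 / (2 * (c₀ : ℝ) + 2)) * ((m k : ℕ) : ℝ) ≤ (k : ℝ) := by
      rw [one_div, inv_mul_le_iff₀ (by positivity)]
      have h3 : ((m k : ℕ) : ℝ) ≤ (c₀ : ℝ) * (k : ℝ) + (c₀ : ℝ) := by exact_mod_cast hm k
      have hk1' : (1 : ℝ) ≤ (k : ℝ) := by exact_mod_cast hk1
      have hc0 : (0 : ℝ) ≤ (c₀ : ℝ) := Nat.cast_nonneg c₀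
      nlinarith [mul_nonneg hc0 (sub_nonneg.mpr hk1')]
    have h4 : ((Nat.log 2 (m k) + c) ^ c : ℝ) < (k : ℝ) := lt_of_lt_of_le h1 h2
    exact_mod_cast h4.le

/-! ### The nonnegative-VP form of the witness -/

/-- **Hrubeš removes the monotone hypothesis from the kill witness.** If some matrix-symmetric
family `h_n ∈ ℝ≥0[x_ij]` whose complexification is a `VP` family separates, for every `c` beyond
every `N`, two `C^{(log₂ m + c)^c}`-equivalent graphs on `Fin m`, then `PolylogWidthMonotoneEasy`
holds: the witness is Hrubeš's monotone-easy `g_n` with `map g_n = (1 + Σ x)^d + ε · map h_n`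
(`sensitiveBridge_proof`); on `C^2`-equivalent graphs the dense part cancels
(`eval_densePart_eq_of_ckEquiv`, taking the hypothesis at level `c + 2 ≥ 2`) and `ε ≠ 0`.
[cite: Hrubes2020, Thm 1] -/
theorem polylogWidthMonotoneEasy_of_nonnegVP
    (h : (n : ℕ) → MvPolynomial (Fin n × Fin n) NNReal)
    (hsymm : ∀ (n : ℕ) (σ τ : Equiv.Perm (Fin n)),
      MvPolynomial.rename (fun p : Fin n × Fin n => (σ p.1, τ p.2)) (h n) = h n)
    (hVP : IsVPFamily (fun n => MvPolynomial.map (Complex.ofRealHom.comp NNReal.toRealHom) (h n)))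
    (hsep : ∀ c N : ℕ, ∃ m : ℕ, N ≤ m ∧ ∃ X Y : SimpleGraph (Fin m),
      CkEquiv ((Nat.log 2 m + c) ^ c) X Y ∧
      MvPolynomial.eval (Set.indicator {ij : Fin m × Fin m | X.Adj ij.1 ij.2} 1)
          (MvPolynomial.map (Complex.ofRealHom.comp NNReal.toRealHom) (h m)) ≠
        MvPolynomial.eval (Set.indicator {ij : Fin m × Fin m | Y.Adj ij.1 ij.2} 1)
          (MvPolynomial.map (Complex.ofRealHom.comp NNReal.toRealHom) (h m))) :
    PolylogWidthMonotoneEasy := by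
  unfold PolylogWidthMonotoneEasy
  obtain ⟨c₀, hc₀⟩ := MonotoneRestorationSensitive.sensitiveBridge_proof h hsymm hVP
  choose d ε hε hd g hg hdeg hgsymm hcomp using hc₀
  refine ⟨g, hgsymm, ⟨c₀, fun n => ⟨hdeg n, hcomp n⟩⟩, ?_⟩
  intro c N
  obtain ⟨m, hNm, X, Y, hXY, hne⟩ := hsep (c + 2) N
  have hlevel2 : 2 ≤ (Nat.log 2 m + (c + 2)) ^ (c + 2) :=
    calc 2 ≤ Nat.log 2 m + (c + 2) := by omega
      _ ≤ (Nat.log 2 m + (c + 2)) ^ (c + 2) := Nat.le_self_pow (by omega) _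
  have hlevel : (Nat.log 2 m + c) ^ c ≤ (Nat.log 2 m + (c + 2)) ^ (c + 2) :=
    calc (Nat.log 2 m + c) ^ c ≤ (Nat.log 2 m + (c + 2)) ^ c := Nat.pow_le_pow_left (by omega) c
      _ ≤ (Nat.log 2 m + (c + 2)) ^ (c + 2) := Nat.pow_le_pow_right (by omega) (by omega)
  refine ⟨m, hNm, X, Y, hXY.mono hlevel, ?_⟩
  have h2 : CkEquiv 2 X Y := hXY.mono hlevel2
  have hdense := eval_densePart_eq_of_ckEquiv h2 le_rfl ℂ (d m)
  rw [indicator_adj_eq_ite, indicator_adj_eq_ite] at hne ⊢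
  rw [hg m]
  simp only [map_add, map_mul, MvPolynomial.eval_C]
  rw [hdense]
  intro heq
  apply hne
  have hε0 : ((ε m : ℝ) : ℂ) ≠ 0 := by exact_mod_cast (hε m).ne'
  exact mul_left_cancel₀ hε0 (add_left_cancel heq)

/-- **The monotone hypothesis of the kill witness is removable** (and only it): the item
`PolylogWidthMonotoneEasy` holds iff some matrix-symmetric family over `ℝ≥0` whose
complexification is a `VP` family (tree `IsVPFamily`) separates, for every `c` beyond every `N`, two
`C^{(log₂ m + c)^c}`-equivalent graphs on `Fin m`. (`→`: `ArithCircuit.complexity_map_le` and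
`targetImpliesCrux_pow_bound`; `←`: `polylogWidthMonotoneEasy_of_nonnegVP`.) This is the
nonnegative, matrix-symmetric, graph-evaluated form of Dwivedi–Pago–Seppelt 2026, Outlook Q3.
[cite: Hrubes2020, Thm 1] [cite: DwivediPagoSeppelt2026, Outlook Q3] -/
theorem polylogWidthMonotoneEasy_iff_nonnegVP :
    PolylogWidthMonotoneEasy ↔
      ∃ h : (n : ℕ) → MvPolynomial (Fin n × Fin n) NNReal,
        (∀ (n : ℕ) (σ τ : Equiv.Perm (Fin n)),
          MvPolynomial.rename (fun p : Fin n × Fin n => (σ p.1, τ p.2)) (h n) = h n) ∧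
        IsVPFamily (fun n => MvPolynomial.map (Complex.ofRealHom.comp NNReal.toRealHom) (h n)) ∧
        ∀ c N : ℕ, ∃ m : ℕ, N ≤ m ∧ ∃ X Y : SimpleGraph (Fin m),
          CkEquiv ((Nat.log 2 m + c) ^ c) X Y ∧
          MvPolynomial.eval (Set.indicator {ij : Fin m × Fin m | X.Adj ij.1 ij.2} 1)
              (MvPolynomial.map (Complex.ofRealHom.comp NNReal.toRealHom) (h m)) ≠
            MvPolynomial.eval (Set.indicator {ij : Fin m × Fin m | Y.Adj ij.1 ij.2} 1)
              (MvPolynomial.map (Complex.ofRealHom.comp NNReal.toRealHom) (h m)) := by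
  unfold PolylogWidthMonotoneEasy
  constructor
  · rintro ⟨f, hsymm, ⟨c, hc⟩, hsep⟩
    refine ⟨f, hsymm, ⟨⟨⟨2, fun n => ?_⟩, ⟨2 * c + 3 ^ c, fun n => ?_⟩⟩,
      ⟨2 * c + 3 ^ c, fun n => ?_⟩⟩, hsep⟩
    · simp only [Fintype.card_prod, Fintype.card_fin]
      nlinarith
    · calc (MvPolynomial.map (Complex.ofRealHom.comp NNReal.toRealHom) (f n)).totalDegree
          ≤ (f n).totalDegree := Finset.sup_mono (MvPolynomial.support_map_subset _ _)
        _ ≤ (n + 2) ^ c := (hc n).1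
        _ ≤ n ^ (2 * c + 3 ^ c) + (2 * c + 3 ^ c) := targetImpliesCrux_pow_bound n c
    · calc complexity (MvPolynomial.map (Complex.ofRealHom.comp NNReal.toRealHom) (f n))
          ≤ complexity (f n) := ArithCircuit.complexity_map_le _ _
        _ ≤ (n + 2) ^ c := (hc n).2
        _ ≤ n ^ (2 * c + 3 ^ c) + (2 * c + 3 ^ c) := targetImpliesCrux_pow_bound n c
  · rintro ⟨h, hsymm, hVP, hsep⟩
    exact polylogWidthMonotoneEasy_of_nonnegVP h hsymm hVP hsep

/-! ### The permanent is a witness if `VP = VNP` -/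

/-- If `VP_ℂ = VNP_ℂ` then the complexification of the permanent over `ℝ≥0` is a `VP` family
(`perFamily_mem_VNP_holds`, `mem_VP_ofFintype_iff_holds`, `map_perPoly`; as in the route's deciding
theorem). [cite: Valiant1979] -/
theorem isVPFamily_map_perPoly_of_VP_eq_VNP (hEq : VP ℂ = VNP ℂ) :
    IsVPFamily (fun n => MvPolynomial.map (Complex.ofRealHom.comp NNReal.toRealHom)
      (perPoly (Fin n) NNReal)) := by
  have hVP : IsVPFamily (fun n => perPoly (Fin n) ℂ) := by
    have hper : perFamily ℂ ∈ VP ℂ := by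
      rw [hEq]; exact perFamily_mem_VNP_holds ℂ
    exact (mem_VP_ofFintype_iff_holds _).1 hper
  have : (fun n => MvPolynomial.map (Complex.ofRealHom.comp NNReal.toRealHom)
      (perPoly (Fin n) NNReal)) = (fun n => perPoly (Fin n) ℂ) :=
    funext fun n => map_perPoly _
  rw [this]
  exact hVP

open Classical in
/-- **The permanent separates polylog-equivalent graphs** (unconditionally): for every `c` beyond
every `N` there are `C^{(log₂ m + c)^c}`-equivalent graphs on `Fin m`, `N ≤ m`, with different
permanents of their adjacency matrices — the CFI matching graphs of Dawar–Wilsenach 2025, Thm 7.2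
(`DawarWilsenach2025_thm72_family`: bipartite, `≡^{C^k}`, `m ≤ c₀ k + c₀`, different numbers of
perfect matchings, hence different permanents by `eval_perPoly_adj_ne_of_card_perfectMatchings_ne`;
`k < m` because `k ≥ m` pebble pairs decide isomorphism, `CkEquiv.nonempty_iso`), taken at an index
`k ≥ (log₂ m + c)^c` (`exists_index_polylog_le`). [cite: DawarWilsenach2025, Thm 7.2] -/
theorem perPoly_separates_polylog : ∀ c N : ℕ, ∃ m : ℕ, N ≤ m ∧ ∃ X Y : SimpleGraph (Fin m),
    CkEquiv ((Nat.log 2 m + c) ^ c) X Y ∧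
    MvPolynomial.eval (Set.indicator {ij : Fin m × Fin m | X.Adj ij.1 ij.2} 1)
        (MvPolynomial.map (Complex.ofRealHom.comp NNReal.toRealHom) (perPoly (Fin m) NNReal)) ≠
      MvPolynomial.eval (Set.indicator {ij : Fin m × Fin m | Y.Adj ij.1 ij.2} 1)
        (MvPolynomial.map (Complex.ofRealHom.comp NNReal.toRealHom) (perPoly (Fin m) NNReal)) := by
  obtain ⟨c₀, hc₀⟩ := CFIMatching.DawarWilsenach2025_thm72_family
  choose m hm X Y hX hY hXY hPM using hc₀
  -- the separated graphs are not isomorphic, so `k < m k`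
  have hkm : ∀ k, k < m k := by
    intro k
    by_contra hk
    have hk' : m k ≤ k := not_lt.mp hk
    apply hPM k
    rcases Nat.eq_zero_or_pos k with h0 | hpos
    · have hXYeq : X k = Y k := by
        ext a b
        exact absurd a.isLt (by omega)
      rw [hXYeq]
    · obtain ⟨e⟩ := (hXY k).nonempty_iso hpos (by simpa using hk')
      exact Literature.Probability.LatticeModels.card_perfectMatchings_eq_of_iso e
  intro c N
  obtain ⟨k, hNk, hlev⟩ := exists_index_polylog_le c₀ hm hkm c N
  refine ⟨m k, hNk, X k, Y k, (hXY k).mono hlev, ?_⟩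
  rw [map_perPoly, indicator_adj_eq_ite, indicator_adj_eq_ite]
  obtain ⟨s, t, hXb, hst⟩ := hX k
  obtain ⟨s', t', hYb, hst'⟩ := hY k
  exact eval_perPoly_adj_ne_of_card_perfectMatchings_ne hXb hst hYb hst' ℂ (hPM k)

/-- **If `VP_ℂ = VNP_ℂ` the kill witness exists**: the permanent over `ℝ≥0` is matrix-symmetric
(`MonotoneRestorationQP.Negative.rename_perm_perPoly`), its complexification is then a `VP` family,
and it separates polylog-equivalent graphs; Hrubeš's bridge makes it monotone-easy
(`polylogWidthMonotoneEasy_of_nonnegVP`). [cite: Hrubes2020, Thm 1]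
[cite: DawarWilsenach2025, Thm 7.2] -/
theorem polylogWidthMonotoneEasy_of_VP_eq_VNP (hEq : VP ℂ = VNP ℂ) : PolylogWidthMonotoneEasy :=
  polylogWidthMonotoneEasy_of_nonnegVP (fun n => perPoly (Fin n) NNReal)
    MonotoneRestorationQP.Negative.rename_perm_perPoly (isVPFamily_map_perPoly_of_VP_eq_VNP hEq)
    perPoly_separates_polylog

/-- **Refuting the kill witness proves the summit**: `¬ PolylogWidthMonotoneEasy → VP_ℂ ≠ VNP_ℂ`.
So the negative side of item `stmt-ValiantsHypothesis-17619` is at least as hard as Valiant's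
hypothesis; together with `WidthKillsRestoration` (`PolylogWidthMonotoneEasy → ¬ MonotoneRestorationQP`)
the route's crux and its kill witness cannot both be cheap. [cite: Hrubes2020, Thm 1]
[cite: DawarWilsenach2025, Thm 7.2] -/
theorem valiantsHypothesis_of_not_polylogWidthMonotoneEasy (h : ¬ PolylogWidthMonotoneEasy) :
    _root_.ValiantsHypothesis := by
  show VP ℂ ≠ VNP ℂ
  intro hEq
  exact h (polylogWidthMonotoneEasy_of_VP_eq_VNP hEq)

end Summit.ValiantsHypothesis.ValiantsHypothesis.Theorems
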